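import Summits.AtomisticToContinuum.Crystallization.Theorems.FreeSplittingCertificatesStrictSplittingRuleLineTrussMajorant

/-!
# `StrictSplittingRule` (stmt-AtomisticToContinuum-12560): the sharp second-order expansion of the outgoing line-truss tail

Route `FreeSplittingCertificates`, crux r3 `StrictSplittingRule`, line `registered` (unit b2b-freesplit-B, gen 14); sequel of
`…LineTrussMajorant.lean`.

* `h1_tail_asymp_sharp` — for `v, e ≠ 0`, `⟪v,e⟫ ≥ 0`:
  `|Σ_{m≥1} W′(‖v+me‖²)⟪v+me,e⟫ + ½V_LJ(‖v‖) + ½W′(‖v‖²)⟪v,e⟫| ≤ ((14 + 56‖v‖⁻⁶)/32)·‖e‖²‖v‖⁻⁸`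

(the sharp trapezoid steps `h1_tail_step_sharp` telescope; `Ψ(n) → 0` by `h1_line_inv_normSq_tendsto_zero`).  Relative to the leading
`‖v‖⁻⁶/12`: `12r⁶τ = 1 − 6r⁶W′(r²)⟪v,e⟫ ± (21/4)(1 + 4r⁻⁶)(‖e‖/r)²`, i.e. the isotropic far-pencil model of the readout is corrected
at first order by `∓3‖e‖cos θ/r` and at second order by at most `5.25(‖e‖/r)²` (true extremal coefficient `7/2`).  The tension
corollaries for the landed design (both orientations, inflation factors from the interface `4.05a` on) are in `…LineTrussInflation.lean`.
Structural bookkeeping ([folklore]); VALUE = a kernel-checked brick of the far lemma (HOME CERT.md §21) — NOT a proof of H12⋆, NOT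
summit progress.
-/

noncomputable section

namespace Summit.AtomisticToContinuum.Crystallization.Theorems.StrictSplittingRuleBirth

open scoped BigOperators Topology
open Filter Set
open Literature.MathematicalPhysics.StatisticalMechanics
open Summit.AtomisticToContinuum.Crystallization.Theorems.PalmUnimodularRigidity.LayeredLawsSelectHcp

/-! ## §6 The assembled sharp expansion -/

section Line4

variable {ρ₀ : ℝ} {v e : EuclideanSpace ℝ (Fin 3)}

/-- Along an outgoing line `(‖v + n e‖²)⁻¹ → 0`. [folklore] -/
theorem h1_line_inv_normSq_tendsto_zero (hρ : 0 < ρ₀) (hv : ρ₀ ≤ ‖v‖) (he : ρ₀ ≤ ‖e‖)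
    (hve : 0 ≤ inner ℝ v e) :
    Tendsto (fun n : ℕ => (‖v + (n : ℝ) • e‖ ^ 2)⁻¹) atTop (𝓝 0) := by
  have hρ2 : 0 < ρ₀ ^ 2 := by positivity
  have hρe : ρ₀ ^ 2 ≤ ‖e‖ ^ 2 := pow_le_pow_left₀ hρ.le he 2
  have hρv : ρ₀ ^ 2 ≤ ‖v‖ ^ 2 := pow_le_pow_left₀ hρ.le hv 2
  have hlow : ∀ n : ℕ, (n : ℝ) * ρ₀ ^ 2 ≤ ‖v + (n : ℝ) • e‖ ^ 2 := by
    intro n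
    have hn : (0 : ℝ) ≤ n := Nat.cast_nonneg n
    have h1 := (h1_line_norm_sq_ge hve hn).1
    have h2 : (n : ℝ) ^ 2 * ‖e‖ ^ 2 ≥ (n : ℝ) ^ 2 * ρ₀ ^ 2 := by gcongr
    nlinarith [sq_nonneg ((n : ℝ) - 1)]
  have hq : Tendsto (fun n : ℕ => ‖v + (n : ℝ) • e‖ ^ 2) atTop atTop :=
    tendsto_atTop_mono hlow (tendsto_natCast_atTop_atTop.atTop_mul_const hρ2)
  exact tendsto_inv_atTop_zero.comp hq

/-- **Sharp second-order expansion of the outgoing line-truss tail.**  For `v ≠ 0`, `e ≠ 0`, `⟪v,e⟫ ≥ 0`: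
`|Σ_{m ≥ 1} W′(‖v+me‖²)⟪v+me,e⟫ + ½V_LJ(‖v‖) + ½W′(‖v‖²)⟪v,e⟫| ≤ ((14 + 56‖v‖⁻⁶)/32)·‖e‖²‖v‖⁻⁸`
(the sharp trapezoid steps `h1_tail_step_sharp` telescope: `Σ_k (Ψ(k+1) − Ψ(k)) = −Ψ(0) = (C‖e‖²/4)‖v‖⁻⁸`).  Relative to the leading
`‖v‖⁻⁶/12` the remainder is `(21/4)(‖e‖/‖v‖)²(1 + 4‖v‖⁻⁶)`; the constant `21/4` is attained asymptotically in the direction `v ∥ e`.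
[folklore] -/
theorem h1_tail_asymp_sharp (hv : 0 < ‖v‖) (he : 0 < ‖e‖) (hve : 0 ≤ inner ℝ v e) :
    |∑' m : ℕ, ljSqDeriv (‖v + ((m : ℝ) + 1) • e‖ ^ 2) * inner ℝ (v + ((m : ℝ) + 1) • e) e +
        1 / 2 * lennardJones ‖v‖ + 1 / 2 * (ljSqDeriv (‖v‖ ^ 2) * inner ℝ v e)| ≤
      (14 + 56 * (‖v‖⁻¹) ^ 6) / 32 * (‖e‖ ^ 2 * (‖v‖⁻¹) ^ 8) := by
  set C : ℝ := 14 + 56 * (‖v‖⁻¹) ^ 6 with hC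
  have hC0 : 0 ≤ C := by positivity
  set ρ₀ := min ‖v‖ ‖e‖ with hρ₀
  have hρ : 0 < ρ₀ := lt_min hv he
  have hρv : ρ₀ ≤ ‖v‖ := min_le_left _ _
  have hρe : ρ₀ ≤ ‖e‖ := min_le_right _ _
  set Φ : ℝ → ℝ := fun t => 1 / 2 * (1 / 12 * ((‖v + t • e‖ ^ 2)⁻¹) ^ 6 - 1 / 6 * ((‖v + t • e‖ ^ 2)⁻¹) ^ 3)
    with hΦ
  set F : ℝ → ℝ := fun t => ljSqDeriv (‖v + t • e‖ ^ 2) * inner ℝ (v + t • e) e with hF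
  set Ψ : ℝ → ℝ := fun t => -(C * ‖e‖ ^ 2 / 4) * ((‖v + t • e‖ ^ 2)⁻¹) ^ 4 with hΨ
  set δ : ℕ → ℝ := fun m => 1 / 8 * (Ψ ((m : ℝ) + 1) - Ψ m) with hδ
  -- summability of the loads
  have hFsum : Summable fun m : ℕ => F ((m : ℝ) + 1) := (h1_master hρ hρv hρe hve).1
  set f : ℕ → ℝ := fun m => F m with hf
  have hf1 : Summable fun m : ℕ => f (m + 1) := hFsum.congr fun m => by simp [hf]
  have hFsum0 : Summable f := (summable_nat_add_iff 1).mp hf1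
  -- the sharp steps
  have hI : ∀ m : ℕ, |F ((m : ℝ) + 1) - (Φ ((m : ℝ) + 1) - Φ m) - 1 / 2 * (F ((m : ℝ) + 1) - F m)| ≤ δ m :=
    fun m => h1_tail_step_sharp hv hve (Nat.cast_nonneg m)
  -- `Ψ` is nonpositive and the partial sums of `δ` telescope
  have hΨle : ∀ t : ℝ, Ψ t ≤ 0 := fun t => by
    simp only [hΨ]
    have : 0 ≤ C * ‖e‖ ^ 2 / 4 * ((‖v + t • e‖ ^ 2)⁻¹) ^ 4 := by positivity
    linarith
  have hδ0 : ∀ m : ℕ, 0 ≤ δ m := fun m => le_trans (abs_nonneg _) (hI m)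
  have hδpart : ∀ n : ℕ, ∑ m ∈ Finset.range n, δ m = 1 / 8 * (Ψ n - Ψ 0) := by
    intro n
    induction n with
    | zero => simp
    | succ n ih => rw [Finset.sum_range_succ, ih, hδ]; push_cast; ring
  have hΨ0 : Ψ 0 = -(C * ‖e‖ ^ 2 / 4) * (‖v‖⁻¹) ^ 8 := by
    simp only [hΨ, zero_smul, add_zero]
    rw [inv_pow, inv_pow, ← pow_mul]
  have hδbd : ∀ n : ℕ, ∑ m ∈ Finset.range n, δ m ≤ C * ‖e‖ ^ 2 / 32 * (‖v‖⁻¹) ^ 8 := by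
    intro n
    rw [hδpart n, hΨ0]
    have := hΨle n
    linarith
  have hδsum : Summable δ := summable_of_sum_range_le hδ0 hδbd
  have hδtsum : ∑' m, δ m ≤ C * ‖e‖ ^ 2 / 32 * (‖v‖⁻¹) ^ 8 := Real.tsum_le_of_sum_range_le hδ0 hδbd
  -- the difference sequences and their sums (as in `h1_tail_asymp2`)
  have hDsum : Summable fun m : ℕ => 1 / 2 * (F ((m : ℝ) + 1) - F m) := (hFsum.sub hFsum0).mul_left (1 / 2)
  have hDtsum : ∑' m : ℕ, 1 / 2 * (F ((m : ℝ) + 1) - F m) = -(1 / 2) * F 0 := by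
    rw [tsum_mul_left, hFsum.tsum_sub hFsum0, hFsum0.tsum_eq_zero_add]
    have e2 : ∑' m : ℕ, f (m + 1) = ∑' m : ℕ, F ((m : ℝ) + 1) := tsum_congr fun m => by simp [hf]
    rw [e2]
    simp only [hf, Nat.cast_zero]
    ring
  have hIsum : Summable fun m : ℕ =>
      F ((m : ℝ) + 1) - (Φ ((m : ℝ) + 1) - Φ m) - 1 / 2 * (F ((m : ℝ) + 1) - F m) :=
    Summable.of_norm_bounded (g := δ) hδsum fun m => by rw [Real.norm_eq_abs]; exact hI m
  have htele : Summable fun m : ℕ => Φ ((m : ℝ) + 1) - Φ m := by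
    have := (hFsum.sub hDsum).sub hIsum
    exact this.congr fun m => by ring
  have htele_sum : ∑' m : ℕ, (Φ ((m : ℝ) + 1) - Φ m) = -Φ 0 := by
    have h1 : Tendsto (fun n : ℕ => ∑ i ∈ Finset.range n, (Φ ((i : ℝ) + 1) - Φ i)) atTop
        (𝓝 (∑' m : ℕ, (Φ ((m : ℝ) + 1) - Φ m))) := htele.hasSum.tendsto_sum_nat
    have h2 : (fun n : ℕ => ∑ i ∈ Finset.range n, (Φ ((i : ℝ) + 1) - Φ i)) = fun n : ℕ => Φ n - Φ 0 := by
      funext n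
      have := Finset.sum_range_sub (fun i : ℕ => Φ i) n
      push_cast at this ⊢
      exact this
    rw [h2] at h1
    have h3 : Tendsto (fun n : ℕ => Φ n - Φ 0) atTop (𝓝 (0 - Φ 0)) :=
      (h1_line_prim_tendsto_zero hρ hρv hρe hve).sub tendsto_const_nhds
    have := tendsto_nhds_unique h1 h3
    rw [this]; ring
  have hΦ0 : Φ 0 = 1 / 2 * lennardJones ‖v‖ := by
    rw [hΦ, lennardJones]
    simp only [zero_smul, add_zero, inv_pow]
    ring
  have hF0 : F 0 = ljSqDeriv (‖v‖ ^ 2) * inner ℝ v e := by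
    simp [hF]
  have hmain : ∑' m : ℕ, F ((m : ℝ) + 1) + Φ 0 + 1 / 2 * F 0 =
      ∑' m : ℕ, (F ((m : ℝ) + 1) - (Φ ((m : ℝ) + 1) - Φ m) - 1 / 2 * (F ((m : ℝ) + 1) - F m)) := by
    rw [(hFsum.sub htele).tsum_sub hDsum, hFsum.tsum_sub htele, htele_sum, hDtsum]
    ring
  -- assemble
  show |∑' m : ℕ, F ((m : ℝ) + 1) + 1 / 2 * lennardJones ‖v‖ + 1 / 2 * (ljSqDeriv (‖v‖ ^ 2) * inner ℝ v e)| ≤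
    C / 32 * (‖e‖ ^ 2 * (‖v‖⁻¹) ^ 8)
  rw [← hΦ0, ← hF0, hmain]
  calc |∑' m : ℕ, (F ((m : ℝ) + 1) - (Φ ((m : ℝ) + 1) - Φ m) - 1 / 2 * (F ((m : ℝ) + 1) - F m))|
      ≤ ∑' m : ℕ, |F ((m : ℝ) + 1) - (Φ ((m : ℝ) + 1) - Φ m) - 1 / 2 * (F ((m : ℝ) + 1) - F m)| :=
        h1_abs_tsum_le hIsum
    _ ≤ ∑' m : ℕ, δ m := Summable.tsum_le_tsum hI hIsum.abs hδsum
    _ ≤ C * ‖e‖ ^ 2 / 32 * (‖v‖⁻¹) ^ 8 := hδtsum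
    _ = C / 32 * (‖e‖ ^ 2 * (‖v‖⁻¹) ^ 8) := by ring

end Line4

end Summit.AtomisticToContinuum.Crystallization.Theorems.StrictSplittingRuleBirth

end
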